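import Mathlib
import HarnessLib
import Literature.MathematicalPhysics.StatisticalMechanics.LennardJonesClusters
import Summits.AtomisticToContinuum.Crystallization.Theorems.ContactSaturationLadderWindowFilling
import Summits.AtomisticToContinuum.Crystallization.Theorems.ContactSaturationLadderWindowFloor
import Summits.AtomisticToContinuum.Crystallization.Theses.ContactSaturationLadder

/-!
# ContactSaturationLadder · E₂ `TwelveGapTextureRung` · line v7 «ClusterLadder» — the CROSS-TERM FLOOR (registered stub `stub_crossTermFloor`)

The half cross energy of the ball cluster `B(p,ρ)` (`ρ ≥ 9`) of a Lennard-Jones ground state with its complement is `≥ −C₂·ρ²`: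

  `∃ C₂, ∀ ρ ≥ 9, ∀ N y, IsGroundState V_LJ y → ∀ p, −C₂ρ² ≤ ½ Σ_{i ∈ B(p,ρ)} Σ_{k ∉ B(p,ρ)} V_LJ(|y_i − y_k|)`.

Mechanism (pure bookkeeping on LANDED lemmas): hard core `δ` (`LennardJonesMinimalDistance_holds`); a site at depth `t` below the
sphere sees the complement only beyond distance `t`, so its cross sum is `≥ −(250/6)δ⁻³max(t,δ)⁻³` (`sum_inv_pow_six_le_two_scale_idx`,
`sum_inv_pow_six_le`, `neg_le_lennardJones_of_le`); the unit layer at integer depth `m ≤ ρ/2` holds `≤ 48δ⁻³(ρ+1)²` sites (`card_layer_le`),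
the core `|y_i − p| ≤ ρ/2` holds `≤ 8ρ³δ⁻³` sites (`card_le_of_separated_of_dist_le`) each contributing `≥ −8Aρ⁻³`; `Σ_m (m+1)⁻³ ≤ 2`.
-/

noncomputable section

namespace Summit.AtomisticToContinuum.Crystallization.Theorems.ContactSaturationLadderCrossTermFloor

open scoped BigOperators Classical
open Metric
open Literature.MathematicalPhysics.StatisticalMechanics (lennardJones IsGroundState LennardJonesMinimalDistance_holds
  sum_inv_pow_six_le neg_le_lennardJones_of_le card_le_of_separated_of_dist_le)
open Summit.AtomisticToContinuum.Crystallization.Theorems.ContactSaturationLadderWindowFilling (sum_inv_pow_six_le_two_scale_idx)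
open Summit.AtomisticToContinuum.Crystallization.Theorems.ContactSaturationLadderWindowFloor (card_layer_le)

variable {N : ℕ}

/-! ## §1 Per-site cross tails -/

/-- A site at depth `≥ r ≥ δ` below the sphere of radius `ρ` about `p` interacts with the sites outside that sphere by at least
`−(1/6)·250·δ⁻³·r⁻³`. -/
theorem site_tail (y : Fin N → EuclideanSpace ℝ (Fin 3)) {δ : ℝ} (hδ : 0 < δ)
    (hsep : ∀ k l : Fin N, k ≠ l → δ ≤ dist (y k) (y l)) (p : EuclideanSpace ℝ (Fin 3)) (ρ : ℝ)
    (T : Finset (Fin N)) (hT : ∀ k ∈ T, ρ < dist (y k) p) {r : ℝ} (hδr : δ ≤ r) {i : Fin N}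
    (hi : dist (y i) p ≤ ρ - r) :
    -((1 / 6) * (250 * δ⁻¹ ^ 3 * r⁻¹ ^ 3)) ≤ ∑ k ∈ T, lennardJones (dist (y i) (y k)) := by
  have hfar : ∀ k ∈ T, r ≤ dist (y i) (y k) := by
    intro k hk
    have hkp := hT k hk
    have ht := dist_triangle (y k) (y i) p
    rw [dist_comm (y k) (y i)] at ht
    linarith
  have hrpos : 0 < r := lt_of_lt_of_le hδ hδr
  have hterm : ∀ k ∈ T, -((1 / 6) * (dist (y i) (y k))⁻¹ ^ 6) ≤ lennardJones (dist (y i) (y k)) := fun k hk =>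
    neg_le_lennardJones_of_le (lt_of_lt_of_le hrpos (hfar k hk)) le_rfl
  have hsumT : -((1 / 6) * ∑ k ∈ T, (dist (y i) (y k))⁻¹ ^ 6) ≤ ∑ k ∈ T, lennardJones (dist (y i) (y k)) := by
    rw [Finset.mul_sum, ← Finset.sum_neg_distrib]
    exact Finset.sum_le_sum hterm
  have h2 := sum_inv_pow_six_le_two_scale_idx y T (y i) hδ hδr (fun k _ l _ hkl => hsep k l hkl) hfar
  linarith

/-- Any site of the window interacts with the outside by at least `−(1/6)·250·δ⁻⁶` (crude skin bound). -/
theorem site_skin (y : Fin N → EuclideanSpace ℝ (Fin 3)) {δ : ℝ} (hδ : 0 < δ)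
    (hsep : ∀ k l : Fin N, k ≠ l → δ ≤ dist (y k) (y l)) (T : Finset (Fin N)) {i : Fin N}
    (hTi : ∀ k ∈ T, k ≠ i) :
    -((1 / 6) * (250 * δ⁻¹ ^ 6)) ≤ ∑ k ∈ T, lennardJones (dist (y i) (y k)) := by
  have hterm : ∀ k ∈ T, -((1 / 6) * (dist (y i) (y k))⁻¹ ^ 6) ≤ lennardJones (dist (y i) (y k)) := fun k hk =>
    neg_le_lennardJones_of_le (lt_of_lt_of_le hδ (hsep i k (hTi k hk).symm)) le_rfl
  have hsumT : -((1 / 6) * ∑ k ∈ T, (dist (y i) (y k))⁻¹ ^ 6) ≤ ∑ k ∈ T, lennardJones (dist (y i) (y k)) := by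
    rw [Finset.mul_sum, ← Finset.sum_neg_distrib]
    exact Finset.sum_le_sum hterm
  have h1 : ∑ k ∈ T, (dist (y i) (y k))⁻¹ ^ 6 ≤ ∑ k ∈ Finset.univ.erase i, (dist (y i) (y k))⁻¹ ^ 6 :=
    Finset.sum_le_sum_of_subset_of_nonneg (fun k hk => Finset.mem_erase.2 ⟨hTi k hk, Finset.mem_univ _⟩)
      (fun _ _ _ => by positivity)
  have h2 := sum_inv_pow_six_le y hδ hsep i
  linarith

/-! ## §2 Counting: unit layers and the core -/

/-- The unit layer `{ρ−m−1 < |y_i − p| ≤ ρ−m}` (`δ ≤ ρ−m−1`, `δ ≤ 1`) holds at most `48δ⁻³(ρ+1)²` sites. -/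
theorem layer_card (y : Fin N → EuclideanSpace ℝ (Fin 3)) {δ : ℝ} (hδ : 0 < δ) (hδ1 : δ ≤ 1)
    (hsep : ∀ k l : Fin N, k ≠ l → δ ≤ dist (y k) (y l)) (p : EuclideanSpace ℝ (Fin 3)) {ρ : ℝ} {m : ℕ}
    (hm : δ ≤ ρ - m - 1) :
    ((Finset.univ.filter fun i : Fin N => ρ - m - 1 < dist (y i) p ∧ dist (y i) p ≤ ρ - m).card : ℝ)
      ≤ 48 * δ⁻¹ ^ 3 * (ρ + 1) ^ 2 := by
  have h := card_layer_le y hδ hsep p hm (by linarith : ρ - m - 1 ≤ ρ - m)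
  have hm0 : (0 : ℝ) ≤ m := Nat.cast_nonneg m
  have hb : 0 ≤ ρ - m - 1 - δ / 2 := by linarith
  have hab : ρ - m - 1 - δ / 2 ≤ ρ - m + δ / 2 := by linarith
  have ha1 : ρ - m + δ / 2 ≤ ρ + 1 := by linarith
  have ha0 : 0 ≤ ρ - m + δ / 2 := hb.trans hab
  have hcube : (ρ - m + δ / 2) ^ 3 - (ρ - m - 1 - δ / 2) ^ 3 ≤ 6 * (ρ + 1) ^ 2 := by
    have h1 : (ρ - m + δ / 2) ^ 3 - (ρ - m - 1 - δ / 2) ^ 3 =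
        (1 + δ) * ((ρ - m + δ / 2) ^ 2 + (ρ - m + δ / 2) * (ρ - m - 1 - δ / 2) + (ρ - m - 1 - δ / 2) ^ 2) := by ring
    have hb2 : (ρ - m - 1 - δ / 2) ^ 2 ≤ (ρ - m + δ / 2) ^ 2 := pow_le_pow_left₀ hb hab 2
    have hab2 : (ρ - m + δ / 2) * (ρ - m - 1 - δ / 2) ≤ (ρ - m + δ / 2) ^ 2 := by
      rw [sq]; exact mul_le_mul_of_nonneg_left hab ha0
    have ha2 : (ρ - m + δ / 2) ^ 2 ≤ (ρ + 1) ^ 2 := pow_le_pow_left₀ ha0 ha1 2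
    have h2 : (ρ - m + δ / 2) ^ 2 + (ρ - m + δ / 2) * (ρ - m - 1 - δ / 2) + (ρ - m - 1 - δ / 2) ^ 2 ≤ 3 * (ρ + 1) ^ 2 := by
      linarith
    have h3 : (0 : ℝ) ≤ 1 + δ := by linarith
    have h4 : (0 : ℝ) ≤ 3 * (ρ + 1) ^ 2 := by positivity
    rw [h1]
    calc (1 + δ) * ((ρ - m + δ / 2) ^ 2 + (ρ - m + δ / 2) * (ρ - m - 1 - δ / 2) + (ρ - m - 1 - δ / 2) ^ 2)
        ≤ (1 + δ) * (3 * (ρ + 1) ^ 2) := mul_le_mul_of_nonneg_left h2 h3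
      _ ≤ 2 * (3 * (ρ + 1) ^ 2) := mul_le_mul_of_nonneg_right (by linarith) h4
      _ = 6 * (ρ + 1) ^ 2 := by ring
  have hδ3 : (0 : ℝ) < (δ / 2) ^ 3 := by positivity
  have hδ0 : δ ≠ 0 := hδ.ne'
  calc ((Finset.univ.filter fun i : Fin N => ρ - m - 1 < dist (y i) p ∧ dist (y i) p ≤ ρ - m).card : ℝ)
      ≤ 6 * (ρ + 1) ^ 2 / (δ / 2) ^ 3 := (le_div_iff₀ hδ3).2 (h.trans hcube)
    _ = 48 * δ⁻¹ ^ 3 * (ρ + 1) ^ 2 := by field_simp; ring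

/-- A `δ`-separated injective configuration has at most `(2R/δ+1)³` sites in the ball `B(p,R)`. -/
theorem core_card (y : Fin N → EuclideanSpace ℝ (Fin 3)) (hy : Function.Injective y) {δ : ℝ} (hδ : 0 < δ)
    (hsep : ∀ k l : Fin N, k ≠ l → δ ≤ dist (y k) (y l)) (p : EuclideanSpace ℝ (Fin 3)) {R : ℝ} (hR : 0 ≤ R) :
    ((Finset.univ.filter fun i : Fin N => dist (y i) p ≤ R).card : ℝ) ≤ (2 * R / δ + 1) ^ 3 := by
  set K := Finset.univ.filter fun i : Fin N => dist (y i) p ≤ R with hK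
  have hcard : (K.image y).card = K.card := Finset.card_image_of_injective K hy
  have hs : ∀ c ∈ K.image y, dist c p ≤ R := by
    intro c hc
    obtain ⟨i, hi, rfl⟩ := Finset.mem_image.1 hc
    exact (Finset.mem_filter.1 hi).2
  have hsep' : ∀ c ∈ K.image y, ∀ d ∈ K.image y, c ≠ d → δ ≤ dist c d := by
    intro c hc d hd hcd
    obtain ⟨i, _, rfl⟩ := Finset.mem_image.1 hc
    obtain ⟨j, _, rfl⟩ := Finset.mem_image.1 hd
    exact hsep i j fun hij => hcd (by rw [hij])
  have h := card_le_of_separated_of_dist_le (K.image y) p hδ hR hs hsep'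
  rw [finrank_euclideanSpace_fin, hcard] at h
  exact h

/-- `Σ_{m<M} (m+1)⁻³ ≤ 2` (compare with the telescoping `2/((m+1)(m+2))`). -/
theorem sum_inv_cube_le (M : ℕ) : ∑ m ∈ Finset.range M, ((m : ℝ) + 1)⁻¹ ^ 3 ≤ 2 := by
  have hle : ∀ m ∈ Finset.range M, ((m : ℝ) + 1)⁻¹ ^ 3 ≤ 2 * (((m : ℝ) + 1)⁻¹ - ((m : ℝ) + 2)⁻¹) := by
    intro m _
    have hm : (0 : ℝ) ≤ m := Nat.cast_nonneg m
    have h0 : (0 : ℝ) < (m : ℝ) + 1 := by positivity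
    have h1 : (0 : ℝ) < (m : ℝ) + 2 := by positivity
    have e1 : ((m : ℝ) + 1)⁻¹ ^ 3 = 1 / ((m : ℝ) + 1) ^ 3 := by rw [inv_pow, one_div]
    have e2 : 2 * (((m : ℝ) + 1)⁻¹ - ((m : ℝ) + 2)⁻¹) = 2 / (((m : ℝ) + 1) * ((m : ℝ) + 2)) := by
      field_simp
      ring
    rw [e1, e2, div_le_div_iff₀ (by positivity) (by positivity)]
    have h2 : (0 : ℝ) ≤ (m : ℝ) ^ 2 := by positivity
    have h3 : (0 : ℝ) ≤ (m : ℝ) ^ 3 := by positivity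
    nlinarith [h2, h3, hm]
  have htele : ∑ m ∈ Finset.range M, (((m : ℝ) + 1)⁻¹ - ((m : ℝ) + 2)⁻¹) = 1 - ((M : ℝ) + 1)⁻¹ := by
    have h := Finset.sum_range_sub' (fun m : ℕ => ((m : ℝ) + 1)⁻¹) M
    have h' : ∀ m ∈ Finset.range M, (((m : ℝ) + 1)⁻¹ - ((m : ℝ) + 2)⁻¹)
        = (fun m : ℕ => ((m : ℝ) + 1)⁻¹) m - (fun m : ℕ => ((m : ℝ) + 1)⁻¹) (m + 1) := by
      intro m _
      simp only [Nat.cast_add, Nat.cast_one]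
      rw [show (m : ℝ) + 1 + 1 = (m : ℝ) + 2 by ring]
    rw [Finset.sum_congr rfl h', h]
    simp
  calc ∑ m ∈ Finset.range M, ((m : ℝ) + 1)⁻¹ ^ 3
      ≤ ∑ m ∈ Finset.range M, 2 * (((m : ℝ) + 1)⁻¹ - ((m : ℝ) + 2)⁻¹) := Finset.sum_le_sum hle
    _ = 2 * (1 - ((M : ℝ) + 1)⁻¹) := by rw [← Finset.mul_sum, htele]
    _ ≤ 2 := by
        have : (0 : ℝ) ≤ ((M : ℝ) + 1)⁻¹ := by positivity
        linarith

/-! ## §3 The registered stub, by name and verbatim signature -/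

/-- **`stub_crossTermFloor`** (registered stub of E₂ `TwelveGapTextureRung`, line v7 «ClusterLadder»): the cross energy of a ball
cluster of a Lennard-Jones ground state with its complement is bounded below by `−C₂·ρ²`. -/
theorem stub_crossTermFloor : ∃ C₂ : ℝ, ∀ ρ : ℝ, 9 ≤ ρ → ∀ (N : ℕ) (y : Fin N → EuclideanSpace ℝ (Fin 3)), Literature.MathematicalPhysics.StatisticalMechanics.IsGroundState Literature.MathematicalPhysics.StatisticalMechanics.lennardJones y → ∀ p : EuclideanSpace ℝ (Fin 3), -C₂ * ρ ^ 2 ≤ (1 / 2) * ∑ i ∈ (Finset.univ.filter fun i : Fin N => dist (y i) p ≤ ρ), ∑ k ∈ Finset.univ.filter (fun k : Fin N => k ∉ (Finset.univ.filter fun i : Fin N => dist (y i) p ≤ ρ)), Literature.MathematicalPhysics.StatisticalMechanics.lennardJones (dist (y i) (y k)) := by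
  obtain ⟨δ₀, hδ₀, hsep₀⟩ := LennardJonesMinimalDistance_holds
  set δ : ℝ := min δ₀ 1 with hδdef
  have hδ : 0 < δ := lt_min hδ₀ one_pos
  have hδ1 : δ ≤ 1 := min_le_right _ _
  have hδle : δ ≤ δ₀ := min_le_left _ _
  set A : ℝ := (1 / 6) * (250 * δ⁻¹ ^ 3) with hA
  have hA0 : 0 < A := by rw [hA]; positivity
  set D : ℝ := 64 * A * δ⁻¹ ^ 3 + 60 * δ⁻¹ ^ 3 * (A * δ⁻¹ ^ 3 + 2 * A) with hD
  refine ⟨D / 2, ?_⟩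
  intro ρ hρ9 N y hy p
  have hρ0 : 0 < ρ := by linarith
  have hsep : ∀ k l : Fin N, k ≠ l → δ ≤ dist (y k) (y l) := fun k l hkl => hδle.trans (hsep₀ N y hy k l hkl)
  have hyinj : Function.Injective y := hy.1
  set W := Finset.univ.filter (fun i : Fin N => dist (y i) p ≤ ρ) with hW
  set T := Finset.univ.filter (fun k : Fin N => k ∉ W) with hT
  have hmW : ∀ i : Fin N, i ∈ W ↔ dist (y i) p ≤ ρ := fun i => by rw [hW]; simp
  have hmT : ∀ k : Fin N, k ∈ T → ρ < dist (y k) p := fun k hk => by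
    rw [hT, Finset.mem_filter, hmW] at hk
    exact not_le.1 hk.2
  have hTi : ∀ i ∈ W, ∀ k ∈ T, k ≠ i := fun i hi k hk h => by
    rw [hT, Finset.mem_filter] at hk
    exact hk.2 (h ▸ hi)
  suffices hmain : -(D * ρ ^ 2) ≤ ∑ i ∈ W, ∑ k ∈ T, lennardJones (dist (y i) (y k)) by
    have : Literature.MathematicalPhysics.StatisticalMechanics.lennardJones = lennardJones := rfl
    linarith
  -- split the window into the core `|y_i − p| ≤ ρ/2` and the outer half
  rw [← Finset.sum_filter_add_sum_filter_not W (fun i : Fin N => dist (y i) p ≤ ρ / 2)]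
  set K := W.filter (fun i : Fin N => dist (y i) p ≤ ρ / 2) with hK
  set O := W.filter (fun i : Fin N => ¬ dist (y i) p ≤ ρ / 2) with hO
  ------------------------------------------------------------------ the core
  have hcore_site : ∀ i ∈ K, -(A * (ρ / 2)⁻¹ ^ 3) ≤ ∑ k ∈ T, lennardJones (dist (y i) (y k)) := by
    intro i hi
    have hi' : dist (y i) p ≤ ρ / 2 := (Finset.mem_filter.1 hi).2
    have h := site_tail y hδ hsep p ρ T hmT (r := ρ / 2) (by linarith) (i := i) (by linarith)
    have hA' : (1 / 6) * (250 * δ⁻¹ ^ 3 * (ρ / 2)⁻¹ ^ 3) = A * (ρ / 2)⁻¹ ^ 3 := by rw [hA]; ring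
    linarith
  have hKcard : (K.card : ℝ) ≤ 8 * ρ ^ 3 * δ⁻¹ ^ 3 := by
    have hKW : K = Finset.univ.filter (fun i : Fin N => dist (y i) p ≤ ρ / 2) := by
      ext i
      rw [hK, Finset.mem_filter, hmW]
      simp only [Finset.mem_filter, Finset.mem_univ, true_and]
      constructor
      · exact fun h => h.2
      · exact fun h => ⟨by linarith, h⟩
    rw [hKW]
    have h := core_card y hyinj hδ hsep p (R := ρ / 2) (by linarith)
    have h1 : 2 * (ρ / 2) / δ + 1 ≤ 2 * ρ / δ := by
      rw [show 2 * (ρ / 2) / δ = ρ / δ by ring, show 2 * ρ / δ = 2 * (ρ / δ) by ring]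
      have : 1 ≤ ρ / δ := by rw [le_div_iff₀ hδ]; linarith
      linarith
    have h0 : 0 ≤ 2 * (ρ / 2) / δ + 1 := by positivity
    calc ((Finset.univ.filter fun i : Fin N => dist (y i) p ≤ ρ / 2).card : ℝ) ≤ (2 * (ρ / 2) / δ + 1) ^ 3 := h
      _ ≤ (2 * ρ / δ) ^ 3 := pow_le_pow_left₀ h0 h1 3
      _ = 8 * ρ ^ 3 * δ⁻¹ ^ 3 := by ring
  have hcore : -(64 * A * δ⁻¹ ^ 3) ≤ ∑ i ∈ K, ∑ k ∈ T, lennardJones (dist (y i) (y k)) := by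
    have h1 := Finset.sum_le_sum hcore_site
    rw [Finset.sum_const, nsmul_eq_mul] at h1
    have h2 : (ρ / 2)⁻¹ ^ 3 = 8 * ρ⁻¹ ^ 3 := by
      rw [inv_div, div_eq_mul_inv, mul_pow]
      norm_num
    have h3 : ρ ^ 3 * ρ⁻¹ ^ 3 = 1 := by rw [← mul_pow, mul_inv_cancel₀ hρ0.ne', one_pow]
    have h4 : (K.card : ℝ) * (A * (ρ / 2)⁻¹ ^ 3) ≤ 64 * A * δ⁻¹ ^ 3 := by
      rw [h2]
      calc (K.card : ℝ) * (A * (8 * ρ⁻¹ ^ 3)) ≤ (8 * ρ ^ 3 * δ⁻¹ ^ 3) * (A * (8 * ρ⁻¹ ^ 3)) :=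
            mul_le_mul_of_nonneg_right hKcard (by positivity)
        _ = 64 * A * δ⁻¹ ^ 3 * (ρ ^ 3 * ρ⁻¹ ^ 3) := by ring
        _ = 64 * A * δ⁻¹ ^ 3 := by rw [h3, mul_one]
    have h5 : (K.card : ℝ) * -(A * (ρ / 2)⁻¹ ^ 3) = -((K.card : ℝ) * (A * (ρ / 2)⁻¹ ^ 3)) := by ring
    linarith
  ------------------------------------------------------------------ the outer half, by unit layers
  set dep : Fin N → ℕ := fun i => ⌊ρ - dist (y i) p⌋₊ with hdep
  set M' : ℕ := ⌊ρ / 2⌋₊ with hM'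
  set w : ℕ → ℝ := fun m => if m = 0 then A * δ⁻¹ ^ 3 else A * (m : ℝ)⁻¹ ^ 3 with hw
  have hmaps : ∀ i ∈ O, dep i ∈ Finset.range (M' + 1) := by
    intro i hi
    have hiO : ¬ dist (y i) p ≤ ρ / 2 := (Finset.mem_filter.1 hi).2
    rw [Finset.mem_range, Nat.lt_add_one_iff]
    apply Nat.floor_le_floor
    linarith [not_le.1 hiO]
  have hfiber : ∀ m ∈ Finset.range (M' + 1),
      -(48 * δ⁻¹ ^ 3 * (ρ + 1) ^ 2 * w m) ≤ ∑ i ∈ O.filter (fun i => dep i = m), ∑ k ∈ T, lennardJones (dist (y i) (y k)) := by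
    intro m hm
    have hmM : m ≤ M' := Nat.lt_add_one_iff.1 (Finset.mem_range.1 hm)
    have hmρ : (m : ℝ) ≤ ρ / 2 := le_trans (Nat.cast_le.2 hmM) (Nat.floor_le (by linarith))
    have hsub : O.filter (fun i => dep i = m) ⊆
        Finset.univ.filter (fun i : Fin N => ρ - m - 1 < dist (y i) p ∧ dist (y i) p ≤ ρ - m) := by
      intro i hi
      rw [Finset.mem_filter] at hi
      obtain ⟨hiO, hmi⟩ := hi
      have hiW : dist (y i) p ≤ ρ := (hmW i).1 (Finset.mem_filter.1 hiO).1
      have ht0 : 0 ≤ ρ - dist (y i) p := by linarith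
      have h1 : ((dep i : ℕ) : ℝ) ≤ ρ - dist (y i) p := Nat.floor_le ht0
      have h2 : ρ - dist (y i) p < (dep i : ℝ) + 1 := Nat.lt_floor_add_one _
      rw [hmi] at h1 h2
      simp only [Finset.mem_filter, Finset.mem_univ, true_and]
      constructor <;> linarith
    have hsite : ∀ i ∈ O.filter (fun i => dep i = m), -w m ≤ ∑ k ∈ T, lennardJones (dist (y i) (y k)) := by
      intro i hi
      have hiL := hsub hi
      simp only [Finset.mem_filter, Finset.mem_univ, true_and] at hiL
      have hiW : i ∈ W := (Finset.mem_filter.1 (Finset.mem_filter.1 hi).1).1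
      by_cases hm0 : m = 0
      · subst hm0
        have hw0 : w 0 = A * δ⁻¹ ^ 3 := by rw [hw]; simp
        rw [hw0]
        have h := site_skin y hδ hsep T (i := i) (hTi i hiW)
        have e : (1 / 6) * (250 * δ⁻¹ ^ 6) = A * δ⁻¹ ^ 3 := by rw [hA]; ring
        linarith
      · have hm1 : (1 : ℝ) ≤ m := by exact_mod_cast Nat.one_le_iff_ne_zero.2 hm0
        have hwm : w m = A * (m : ℝ)⁻¹ ^ 3 := by rw [hw]; simp [hm0]
        rw [hwm]
        have h := site_tail y hδ hsep p ρ T hmT (r := (m : ℝ)) (hδ1.trans hm1) (i := i) hiL.2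
        have e : (1 / 6) * (250 * δ⁻¹ ^ 3 * (m : ℝ)⁻¹ ^ 3) = A * (m : ℝ)⁻¹ ^ 3 := by rw [hA]; ring
        linarith
    have hw0 : 0 ≤ w m := by
      rw [hw]
      simp only
      split_ifs <;> positivity
    have hLcard := layer_card y hδ hδ1 hsep p (ρ := ρ) (m := m) (by linarith)
    have hFcard : ((O.filter (fun i => dep i = m)).card : ℝ) ≤ 48 * δ⁻¹ ^ 3 * (ρ + 1) ^ 2 :=
      le_trans (by exact_mod_cast Finset.card_le_card hsub) hLcard
    have h1 := Finset.sum_le_sum hsite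
    rw [Finset.sum_const, nsmul_eq_mul] at h1
    have h2 : ((O.filter (fun i => dep i = m)).card : ℝ) * w m ≤ 48 * δ⁻¹ ^ 3 * (ρ + 1) ^ 2 * w m :=
      mul_le_mul_of_nonneg_right hFcard hw0
    have h3 : ((O.filter (fun i => dep i = m)).card : ℝ) * -w m = -(((O.filter (fun i => dep i = m)).card : ℝ) * w m) := by
      ring
    linarith
  have hwsum : ∑ m ∈ Finset.range (M' + 1), w m ≤ A * δ⁻¹ ^ 3 + 2 * A := by
    rw [Finset.sum_range_succ']
    have h0 : w 0 = A * δ⁻¹ ^ 3 := by rw [hw]; simp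
    have h1 : ∀ m ∈ Finset.range M', w (m + 1) = A * ((m : ℝ) + 1)⁻¹ ^ 3 := by
      intro m _
      rw [hw]
      simp only [Nat.add_one_ne_zero, if_false, Nat.cast_add, Nat.cast_one]
    rw [h0, Finset.sum_congr rfl h1, ← Finset.mul_sum]
    have h2 := sum_inv_cube_le M'
    have h3 : A * ∑ m ∈ Finset.range M', ((m : ℝ) + 1)⁻¹ ^ 3 ≤ A * 2 := mul_le_mul_of_nonneg_left h2 hA0.le
    linarith
  have houter : -(48 * δ⁻¹ ^ 3 * (ρ + 1) ^ 2 * (A * δ⁻¹ ^ 3 + 2 * A)) ≤ ∑ i ∈ O, ∑ k ∈ T, lennardJones (dist (y i) (y k)) := by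
    rw [← Finset.sum_fiberwise_of_maps_to hmaps (fun i => ∑ k ∈ T, lennardJones (dist (y i) (y k)))]
    have h1 := Finset.sum_le_sum hfiber
    have h2 : ∑ m ∈ Finset.range (M' + 1), (-(48 * δ⁻¹ ^ 3 * (ρ + 1) ^ 2 * w m))
        = -(48 * δ⁻¹ ^ 3 * (ρ + 1) ^ 2) * ∑ m ∈ Finset.range (M' + 1), w m := by
      rw [Finset.mul_sum]
      exact Finset.sum_congr rfl fun m _ => by ring
    rw [h2] at h1
    have h3 : 0 ≤ 48 * δ⁻¹ ^ 3 * (ρ + 1) ^ 2 := by positivity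
    have h4 := mul_le_mul_of_nonneg_left hwsum h3
    linarith
  ------------------------------------------------------------------ conclusion
  have h48 : 48 * (ρ + 1) ^ 2 ≤ 60 * ρ ^ 2 := by
    nlinarith [mul_nonneg (by linarith : (0 : ℝ) ≤ ρ - 9) (by linarith : (0 : ℝ) ≤ ρ + 1)]
  have hB0 : 0 ≤ A * δ⁻¹ ^ 3 + 2 * A := by positivity
  have hδ3 : 0 ≤ δ⁻¹ ^ 3 := by positivity
  have hρ2 : 1 ≤ ρ ^ 2 := by nlinarith
  have e1 : 64 * A * δ⁻¹ ^ 3 ≤ 64 * A * δ⁻¹ ^ 3 * ρ ^ 2 := le_mul_of_one_le_right (by positivity) hρ2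
  have e2 : 48 * δ⁻¹ ^ 3 * (ρ + 1) ^ 2 * (A * δ⁻¹ ^ 3 + 2 * A) ≤ 60 * δ⁻¹ ^ 3 * (A * δ⁻¹ ^ 3 + 2 * A) * ρ ^ 2 := by
    calc 48 * δ⁻¹ ^ 3 * (ρ + 1) ^ 2 * (A * δ⁻¹ ^ 3 + 2 * A)
        = (δ⁻¹ ^ 3 * (A * δ⁻¹ ^ 3 + 2 * A)) * (48 * (ρ + 1) ^ 2) := by ring
      _ ≤ (δ⁻¹ ^ 3 * (A * δ⁻¹ ^ 3 + 2 * A)) * (60 * ρ ^ 2) := mul_le_mul_of_nonneg_left h48 (mul_nonneg hδ3 hB0)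
      _ = 60 * δ⁻¹ ^ 3 * (A * δ⁻¹ ^ 3 + 2 * A) * ρ ^ 2 := by ring
  have hDρ : D * ρ ^ 2 = 64 * A * δ⁻¹ ^ 3 * ρ ^ 2 + 60 * δ⁻¹ ^ 3 * (A * δ⁻¹ ^ 3 + 2 * A) * ρ ^ 2 := by rw [hD]; ring
  linarith [hcore, houter]

/-- The stub IS the node's piece `∃ C₂, CrossTermFloor C₂` (rfl pin against the line-v7 statement shape). -/
example : ∃ C₂ : ℝ, ∀ ρ : ℝ, 9 ≤ ρ → ∀ (N : ℕ) (y : Fin N → EuclideanSpace ℝ (Fin 3)), IsGroundState lennardJones y →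
    ∀ p : EuclideanSpace ℝ (Fin 3), -C₂ * ρ ^ 2 ≤ (1 / 2) * ∑ i ∈ (Finset.univ.filter fun i : Fin N => dist (y i) p ≤ ρ),
      ∑ k ∈ Finset.univ.filter (fun k : Fin N => k ∉ (Finset.univ.filter fun i : Fin N => dist (y i) p ≤ ρ)),
        lennardJones (dist (y i) (y k)) :=
  stub_crossTermFloor

end Summit.AtomisticToContinuum.Crystallization.Theorems.ContactSaturationLadderCrossTermFloor

end
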